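import Literature.Geometry.Lorentzian.ChainUnionDataEmbedding
import Literature.Geometry.Lorentzian.TimelikeCurveLift
import Literature.Geometry.Lorentzian.CauchyProblemMGHDExistenceProofs
import HarnessLib

/-!
# The union of a chain of Cauchy developments, II: it is a Cauchy development bounding the chain;
# MGHD existence from local existence and common extensions
# (Choquet-Bruhat–Geroch 1969, proof of Thm. 3, p. 333: "each totally ordered subset of `𝓜` has an upper bound")

Final file of the union-of-a-chain construction (`ChainDirectLimitData`, `ChainUnionDataEmbedding`).
Choquet-Bruhat–Geroch, Comm. Math. Phys. 14 (1969), proof of Thm. 3, p. 333: *"`K̃` is a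
development of `S`, and `K̃ ≥ N_α` for each `α`. We have shown that each totally ordered subset of
`𝓜` has an upper bound."*

* `CauchyDevelopment.isCauchyHypersurface_chain` — **the data hypersurface is a Cauchy
  hypersurface of the union `K̃`**: an endless timelike curve of `K̃` meets it (the piece of the
  curve inside the image of some `N_α` lifts to an endless timelike curve of `N_α`,
  `LorentzianMetric.exists_lift_isEndlessTimelikeCurve`, which meets the Cauchy hypersurface
  `ι_α(S)`), and at most once (the compact arc between two crossings lies in the image of ONE piece,
  `Literature.Topology.exists_subset_range_directLimitMk_of_isCompact`, where it would give a
  timelike curve meeting `ι_α(S)` twice, `IsCauchyHypersurface.eq_of_mem_of_mem`);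
* `CauchyDevelopment.chainCauchyDevelopment`, `chainVacuumCauchyDevelopment`,
  `embedsInto_chainCauchyDevelopment` — *"`K̃` is a development of `S`, and `K̃ ≥ N_α`"*;
* `CauchyDevelopment.exists_greatest_or_cofinal_seq` — **a chain of developments either has a
  greatest element or a cofinal sequence**: the union over the whole chain (one universe up) is
  second countable (Geroch 1968), so countably many images `incl(N_α)` cover it; a member above all
  of them has the whole union as image, and then dominates the chain (an onto embedding of
  developments is invertible, `CauchyDevelopment.embedsInto_of_surjective`);
* `CauchyDevelopment.exists_upperBound_of_isChain`, `VacuumCauchyDevelopment.exists_upperBound_of_isChain`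
  — **every nonempty chain of (vacuum) Cauchy developments has an upper bound** in the same
  universe: the greatest element, or the union of a cofinal sequence (indexed in `Type`, so that
  its carrier lies in the universe of the data);
* `VacuumCauchyDevelopment.exists_isMaximal_of_nonempty_of_common_extension` and
  `choquetBruhat_geroch_exists_mghd_cauchy_of_localExistence_of_common_extension` — **the input
  `hchain` of the Zorn frame (`CauchyProblemMGHDExistenceProofs`) is discharged up to local
  existence**: MGHD existence (Choquet-Bruhat–Geroch 1969, Thm. 3; the named fact
  `choquetBruhat_geroch_exists_mghd_cauchy`) follows from (i) the existence of ONE vacuum Cauchy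
  development of every datum (Choquet-Bruhat 1952, local existence) and (ii) common extensions
  (Sbierski 2016, Thm. 5, reduced in `DevelopmentGluing` to the local theory and Thm. 17).

## References

* Y. Choquet-Bruhat, R. Geroch, Comm. Math. Phys. 14 (1969) 329–335, proof of Thm. 3, p. 333.
  [ChoquetBruhatGeroch1969CMP]
* J. Sbierski, Ann. Henri Poincaré 17 (2016) 301–329 = arXiv:1309.7591v3, §3.3. [Sbierski2016AHP]
* R. Geroch, J. Math. Phys. 9 (1968) 1739–1744, Appendix. [Geroch1968JMP]
-/

noncomputable section

open scoped Manifold ContDiff Topology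
open Bundle Set Function Filter _root_.Topology Literature.Geometry.Manifold

namespace Literature.Geometry.Lorentzian

universe u

variable {n : ℕ} {X : Type u} [TopologicalSpace X] [ChartedSpace (EuclideanSpace ℝ (Fin n)) X]
  [IsManifold (𝓡 n) ∞ X] [ConnectedSpace X] {D : InitialDataSet (𝓡 n) X}

namespace CauchyDevelopment

attribute [local instance] chainPreorder

variable {c : Set (CauchyDevelopment D)} {K : Type} [Preorder K] [IsDirectedOrder K] [Nonempty K]

/-! ### The data hypersurface is a Cauchy hypersurface of the union -/

/-- **A piece of an endless timelike curve of `K̃` inside the image of `N_j` meets the data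
hypersurface, at most once** (lift to `N_j`, where `ι_j(S)` is a Cauchy hypersurface).
[cite: ChoquetBruhatGeroch1969CMP, proof of Thm. 3 (p. 333)] -/
theorem crossing_chainIncl (hc : IsChain EmbedsInto c) (f : K → ↥c) (hf : Monotone f) (j₀ : K)
    {γ : ℝ → (chainSpacetime hc f hf).carrier} {s : Set ℝ}
    (hγ : (chainSpacetime hc f hf).metric.IsEndlessTimelikeCurve
      (chainSpacetime hc f hf).timeOrientation γ s)
    {t₀ : ℝ} (ht₀ : t₀ ∈ s) {j : K} (hγt₀ : γ t₀ ∈ range (chainIncl hc f hf j)) :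
    (∃ t ∈ connectedComponentIn (s ∩ γ ⁻¹' range (chainIncl hc f hf j)) t₀,
        γ t ∈ range (chainDataEmbedding hc f hf j₀).embed) ∧
      ∀ t₁ ∈ connectedComponentIn (s ∩ γ ⁻¹' range (chainIncl hc f hf j)) t₀,
        ∀ t₂ ∈ connectedComponentIn (s ∩ γ ⁻¹' range (chainIncl hc f hf j)) t₀,
          γ t₁ ∈ range (chainDataEmbedding hc f hf j₀).embed →
            γ t₂ ∈ range (chainDataEmbedding hc f hf j₀).embed → t₁ = t₂ := by
  obtain ⟨δ, hδ, hδc⟩ := LorentzianMetric.exists_lift_isEndlessTimelikeCurve (f j).1.timeOrientation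
    (chainSpacetime hc f hf).timeOrientation (isIsometricImmersion_chainIncl hc f hf j)
    (preservesTimeOrientation_chainIncl hc f hf j) (isOpenEmbedding_chainIncl hc f hf j).injective
    (isLocalDiffeomorph_chainIncl hc f hf j) hγ ht₀ hγt₀
  -- a crossing of the lift is a crossing of `γ`, and conversely (the data hypersurface of `K̃` is
  -- `incl j (ι_j S)` for every `j`)
  have hmem : ∀ t ∈ connectedComponentIn (s ∩ γ ⁻¹' range (chainIncl hc f hf j)) t₀,
      (γ t ∈ range (chainDataEmbedding hc f hf j₀).embed ↔ δ t ∈ range (f j).1.embed) := by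
    intro t ht
    rw [chainDataEmbedding_embed]
    constructor
    · rintro ⟨x, hx⟩
      refine ⟨x, (isOpenEmbedding_chainIncl hc f hf j).injective ?_⟩
      rw [hδ t ht, ← hx, comp_apply, chainIncl_embed hc f hf j₀ j]
    · rintro ⟨x, hx⟩
      refine ⟨x, ?_⟩
      rw [comp_apply, chainIncl_embed hc f hf j₀ j, hx, hδ t ht]
  refine ⟨?_, fun t₁ ht₁ t₂ ht₂ h₁ h₂ ↦ ?_⟩
  · obtain ⟨t, ⟨ht, hx⟩, -⟩ := (f j).1.isCauchyHypersurface δ _ hδc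
    exact ⟨t, ht, (hmem t ht).2 hx⟩
  · exact LorentzianMetric.IsCauchyHypersurface.eq_of_mem_of_mem (WithTop.coe_le_coe.mpr le_top)
      (f j).1.isCauchyHypersurface hδc.1 hδc.2.1 ht₁ ht₂ ((hmem t₁ ht₁).1 h₁) ((hmem t₂ ht₂).1 h₂)

/-- **The data hypersurface `ι̃(S)` is a Cauchy hypersurface of the union `K̃`** ("`K̃` is a
development of `S`"): an endless timelike curve meets it — the piece through any of its points
inside the image of some `N_j` does (`crossing_chainIncl`) — and at most once: the compact arc
between two crossings lies in the image of a single piece (the images form a directed open cover,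
`Literature.Topology.exists_subset_range_directLimitMk_of_isCompact`), where two crossings are
impossible. [cite: ChoquetBruhatGeroch1969CMP, proof of Thm. 3 (p. 333)] -/
theorem isCauchyHypersurface_chain (hc : IsChain EmbedsInto c) (f : K → ↥c) (hf : Monotone f)
    (j₀ : K) :
    (chainSpacetime hc f hf).metric.IsCauchyHypersurface (chainSpacetime hc f hf).timeOrientation
      (range (chainDataEmbedding hc f hf j₀).embed) := by
  intro γ s hγ
  obtain ⟨t₀, ht₀⟩ := hγ.2.2.1.1
  -- existence of a crossing
  obtain ⟨j, x, hx⟩ := exists_eq_chainIncl hc f hf (γ t₀)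
  obtain ⟨⟨tc, htc, hxc⟩, -⟩ := crossing_chainIncl hc f hf j₀ hγ ht₀ (j := j) ⟨x, hx.symm⟩
  refine ⟨tc, ⟨(connectedComponentIn_subset _ _ htc).1, hxc⟩, fun t ⟨ht, hxt⟩ ↦ ?_⟩
  -- uniqueness
  have htcs : tc ∈ s := (connectedComponentIn_subset _ _ htc).1
  by_contra hne
  -- the compact arc between the two crossings lies in the image of one piece
  have hcont : ContinuousOn γ s := fun t ht ↦ (hγ.2.1 t ht).1.continuousAt.continuousWithinAt
  have key : ∀ {a b : ℝ}, a ∈ s → b ∈ s → a ≤ b →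
      γ a ∈ range (chainDataEmbedding hc f hf j₀).embed →
      γ b ∈ range (chainDataEmbedding hc f hf j₀).embed → a = b := by
    intro a b ha hb hab hxa hxb
    have hI : Icc a b ⊆ s := hγ.1.out ha hb
    have hcpt : IsCompact (γ '' Icc a b) := isCompact_Icc.image_of_continuousOn (hcont.mono hI)
    obtain ⟨i, hi⟩ := (chainDataJ hc f hf).exists_subset_range_incl_of_isCompact hcpt
    have hsub : Icc a b ⊆ s ∩ γ ⁻¹' range (chainIncl hc f hf i) := fun t ht ↦
      ⟨hI ht, hi (mem_image_of_mem γ ht)⟩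
    have hconn : Icc a b ⊆ connectedComponentIn (s ∩ γ ⁻¹' range (chainIncl hc f hf i)) a :=
      isPreconnected_Icc.subset_connectedComponentIn (left_mem_Icc.2 hab) hsub
    obtain ⟨-, huniq⟩ := crossing_chainIncl hc f hf j₀ hγ ha (j := i)
      (hi (mem_image_of_mem γ (left_mem_Icc.2 hab)))
    exact huniq a (hconn (left_mem_Icc.2 hab)) b (hconn (right_mem_Icc.2 hab)) hxa hxb
  rcases lt_or_gt_of_ne hne with hlt | hlt
  · exact hne (key ht htcs hlt.le hxt hxc)
  · exact hne (key htcs ht hlt.le hxc hxt).symm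

/-- **The union `K̃` of the (re-indexed) chain as a Cauchy development of `D`** ("`K̃` is a
development of `S`"). [cite: ChoquetBruhatGeroch1969CMP, proof of Thm. 3 (p. 333)] -/
def chainCauchyDevelopment (hc : IsChain EmbedsInto c) (f : K → ↥c) (hf : Monotone f) (j₀ : K) :
    CauchyDevelopment D where
  toDataEmbedding := chainDataEmbedding hc f hf j₀
  isCauchyHypersurface := isCauchyHypersurface_chain hc f hf j₀

/-- **"`K̃ ≥ N_α` for each `α`"**: every piece embeds into the union. [cite: ChoquetBruhatGeroch1969CMP, proof of Thm. 3 (p. 333)] -/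
theorem embedsInto_chainCauchyDevelopment (hc : IsChain EmbedsInto c) (f : K → ↥c) (hf : Monotone f)
    (j₀ j : K) : (f j).1.EmbedsInto (chainCauchyDevelopment hc f hf j₀) :=
  embedsInto_chainDataEmbedding hc f hf j₀ j

/-- **The union of a chain of vacuum developments is a vacuum Cauchy development.**
[cite: ChoquetBruhatGeroch1969CMP, proof of Thm. 3 (p. 333)] -/
def chainVacuumCauchyDevelopment (hc : IsChain EmbedsInto c) (f : K → ↥c) (hf : Monotone f)
    (j₀ : K) (hvac : ∀ j, (f j).1.toDataEmbedding.IsVacuum) : VacuumCauchyDevelopment D where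
  toCauchyDevelopment := chainCauchyDevelopment hc f hf j₀
  isRicciFlat := by
    intro inst
    haveI : (chainDataEmbedding hc f hf j₀).metric.toPseudoRiemannianMetric.HasLeviCivita := inst
    exact isVacuum_chainDataEmbedding hc f hf j₀ hvac

/-! ### Greatest elements and cofinal sequences -/

/-- A chain of developments is totally preordered. [folklore] -/
theorem chain_le_total (hc : IsChain EmbedsInto c) (a b : ↥c) : a ≤ b ∨ b ≤ a := by
  by_cases hab : a.1 = b.1
  · exact Or.inl (chain_le_iff.2 (hab ▸ EmbedsInto.refl a.1))
  · exact hc a.2 b.2 hab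

/-- **A member of the chain whose image is the whole union dominates the chain**: if
`incl a (N_a) = K̃⁺` (the union over the whole chain) then every `b` embeds into `a` — for `a ≤ b`
the embedding `ψ_ab` is then onto, hence invertible (`embedsInto_of_surjective`).
[cite: ChoquetBruhatGeroch1969CMP, proof of Thm. 3 (p. 333)] -/
theorem le_of_range_chainIncl_eq_univ (hc : IsChain EmbedsInto c) [Nonempty ↥c] {a : ↥c}
    (ha : letI := isDirectedOrder_chain hc
      range (chainIncl hc id monotone_id a) = univ) (b : ↥c) : b ≤ a := by
  letI := isDirectedOrder_chain hc
  rcases chain_le_total hc b a with h | h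
  · exact h
  · -- `ψ_ab` is onto
    have hsurj : Surjective (chainMap a b h) := fun y ↦ by
      have hy : chainIncl hc id monotone_id b y ∈
          range (chainIncl hc id monotone_id a) := ha ▸ mem_univ _
      obtain ⟨x, hx⟩ := hy
      refine ⟨x, (isOpenEmbedding_chainIncl hc _ monotone_id b).injective ?_⟩
      exact (chainIncl_chainMap hc id monotone_id h x).trans hx
    exact embedsInto_of_surjective (chainMap_isIsometricImmersion a b h)
      (chainMap_preservesTimeOrientation a b h) (chainMap_comp_embed a b h)
      (isOpenEmbedding_chainMap a b h).injective hsurj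

/-- **A nonempty chain of Cauchy developments has a greatest element or a cofinal sequence.** The
union `K̃⁺` over the whole chain is second countable (Geroch 1968, via
`SmoothDirectLimitData.secondCountableTopology_limit_of_lorentzian`), so countably many images
`incl(N_α)` cover it; if some member lies above all of these, its image is everything and it is
greatest (`le_of_range_chainIncl_eq_univ`); otherwise the countable family is cofinal.
[cite: Geroch1968JMP, Appendix] [cite: ChoquetBruhatGeroch1969CMP, proof of Thm. 3 (p. 333)] -/
theorem exists_greatest_or_cofinal_seq (hc : IsChain EmbedsInto c) (hne : c.Nonempty) :
    (∃ m : ↥c, ∀ a : ↥c, a ≤ m) ∨ ∃ f : ℕ → ↥c, ∀ a : ↥c, ∃ k, a ≤ f k := by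
  haveI : Nonempty ↥c := hne.to_subtype
  letI := isDirectedOrder_chain hc
  haveI : SecondCountableTopology (chainSpacetime hc (id : ↥c → ↥c) monotone_id).carrier :=
    (chainSpacetime hc (id : ↥c → ↥c) monotone_id).secondCountableTopology
  -- the union over the whole chain and the open cover by the images of the pieces
  set U : ↥c → Set (chainSpacetime hc (id : ↥c → ↥c) monotone_id).carrier :=
    fun a ↦ range (chainIncl hc id monotone_id a) with hU
  obtain ⟨T, hTc, hTU⟩ := TopologicalSpace.isOpen_iUnion_countable U
    fun a ↦ (isOpenEmbedding_chainIncl hc _ monotone_id a).isOpen_range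
  have hcov : ⋃ a, U a = univ := by
    refine eq_univ_of_forall fun z ↦ ?_
    obtain ⟨a, x, rfl⟩ := exists_eq_chainIncl hc id monotone_id z
    exact mem_iUnion.2 ⟨a, x, rfl⟩
  -- enumerate the countable subfamily (nonempty after adding a member)
  obtain ⟨a₀⟩ := ‹Nonempty ↥c›
  obtain ⟨f, hf⟩ := (hTc.insert a₀).exists_eq_range (insert_nonempty a₀ T)
  by_cases h : ∃ a : ↥c, ∀ k, ¬ a ≤ f k
  · -- a member above the whole subfamily: its image is everything, so it is greatest
    obtain ⟨a, ha⟩ := h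
    left
    refine ⟨a, le_of_range_chainIncl_eq_univ hc ?_⟩
    refine eq_univ_of_forall fun z ↦ ?_
    have hz : z ∈ ⋃ b ∈ T, U b := by rw [hTU, hcov]; exact mem_univ z
    obtain ⟨b, hbT, hzb⟩ := mem_iUnion₂.1 hz
    have hbf : b ∈ range f := hf ▸ mem_insert_of_mem a₀ hbT
    obtain ⟨k, rfl⟩ := hbf
    have hle : f k ≤ a := (chain_le_total hc (f k) a).resolve_right (ha k)
    exact (chainDataJ hc id monotone_id).range_incl_mono hle hzb
  · right
    push Not at h
    exact ⟨f, h⟩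

/-! ### The index type of a cofinal sequence -/

/-- The index type of a sequence `f : ℕ → ↥c` in the chain: `ℕ` with the chain preorder pulled
back along `f` (so that `f` is monotone and, the chain being total, the index type is directed).
A type in `Type`, so that the union over it has its carrier in the universe of the data. [folklore] -/
def SeqIndex (_f : ℕ → ↥c) : Type := ℕ

/-- The pulled-back chain preorder on `SeqIndex f`. [folklore] -/
instance instPreorderSeqIndex (f : ℕ → ↥c) : Preorder (SeqIndex f) := Preorder.lift f

/-- `SeqIndex f` is nonempty. [folklore] -/
instance instNonemptySeqIndex (f : ℕ → ↥c) : Nonempty (SeqIndex f) := ⟨(0 : ℕ)⟩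

/-- The sequence as a monotone map `SeqIndex f → ↥c`. [folklore] -/
theorem monotone_seqIndex (f : ℕ → ↥c) : Monotone (fun k : SeqIndex f ↦ f k) := fun _ _ h ↦ h

/-- `SeqIndex f` is directed (the chain is total). [folklore] -/
theorem isDirectedOrder_seqIndex (hc : IsChain EmbedsInto c) (f : ℕ → ↥c) :
    IsDirectedOrder (SeqIndex f) :=
  ⟨fun k m ↦ by
    rcases chain_le_total hc (f k) (f m) with h | h
    · exact ⟨m, h, le_refl (f m)⟩
    · exact ⟨k, le_refl (f k), h⟩⟩

/-! ### Upper bounds of chains -/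

/-- **Every nonempty chain of Cauchy developments has an upper bound** (Choquet-Bruhat–Geroch
1969, proof of Thm. 3, p. 333: "each totally ordered subset of `𝓜` has an upper bound"): its
greatest element if it has one, and otherwise the union `K̃` of a cofinal sequence
(`exists_greatest_or_cofinal_seq`, `chainCauchyDevelopment`). [cite: ChoquetBruhatGeroch1969CMP, proof of Thm. 3 (p. 333)] -/
theorem exists_upperBound_of_isChain (hc : IsChain EmbedsInto c) (hne : c.Nonempty) :
    ∃ ub : CauchyDevelopment.{u} D, ∀ a ∈ c, a.EmbedsInto ub := by
  rcases exists_greatest_or_cofinal_seq hc hne with ⟨m, hm⟩ | ⟨f, hf⟩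
  · exact ⟨m.1, fun a ha ↦ hm ⟨a, ha⟩⟩
  · letI := isDirectedOrder_seqIndex hc f
    refine ⟨chainCauchyDevelopment hc (fun k : SeqIndex f ↦ f k) (monotone_seqIndex f) (0 : ℕ),
      fun a ha ↦ ?_⟩
    obtain ⟨k, hk⟩ := hf ⟨a, ha⟩
    exact DataEmbedding.EmbedsInto.trans hk
      (embedsInto_chainCauchyDevelopment hc (fun k : SeqIndex f ↦ f k) (monotone_seqIndex f)
        (0 : ℕ) k)

end CauchyDevelopment

/-! ### Vacuum chains, and MGHD existence from local existence and common extensions -/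

namespace VacuumCauchyDevelopment

attribute [local instance] CauchyDevelopment.chainPreorder

/-- **Every nonempty chain of vacuum Cauchy developments has an upper bound** among vacuum
Cauchy developments (the greatest element, or the union of a cofinal sequence, which is vacuum:
`chainVacuumCauchyDevelopment`). [cite: ChoquetBruhatGeroch1969CMP, proof of Thm. 3 (p. 333)] -/
theorem exists_upperBound_of_isChain {c : Set (VacuumCauchyDevelopment.{u} D)}
    (hc : IsChain (fun 𝒟₁ 𝒟₂ ↦ 𝒟₁.toCauchyDevelopment.EmbedsInto 𝒟₂.toCauchyDevelopment) c)
    (hne : c.Nonempty) :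
    ∃ ub : VacuumCauchyDevelopment.{u} D, ∀ 𝒟 ∈ c, 𝒟.toCauchyDevelopment.EmbedsInto ub.toCauchyDevelopment := by
  -- the chain of underlying Cauchy developments
  set c' : Set (CauchyDevelopment D) := toCauchyDevelopment '' c with hc'
  have hc'c : IsChain CauchyDevelopment.EmbedsInto c' := by
    rintro _ ⟨a, ha, rfl⟩ _ ⟨b, hb, rfl⟩ hab
    exact hc ha hb fun h ↦ hab (h ▸ rfl)
  have hne' : c'.Nonempty := hne.image _
  have hvac' : ∀ a ∈ c', a.toDataEmbedding.IsVacuum := by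
    rintro _ ⟨a, -, rfl⟩
    exact a.isVacuum
  rcases CauchyDevelopment.exists_greatest_or_cofinal_seq hc'c hne' with ⟨m, hm⟩ | ⟨f, hf⟩
  · obtain ⟨m₀, hm₀, hm₀m⟩ := m.2
    refine ⟨m₀, fun 𝒟 h𝒟 ↦ ?_⟩
    rw [hm₀m]
    exact hm ⟨_, mem_image_of_mem _ h𝒟⟩
  · letI := CauchyDevelopment.isDirectedOrder_seqIndex hc'c f
    refine ⟨CauchyDevelopment.chainVacuumCauchyDevelopment hc'c
      (fun k : CauchyDevelopment.SeqIndex f ↦ f k) (CauchyDevelopment.monotone_seqIndex f) (0 : ℕ)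
      (fun k ↦ hvac' _ (f k).2), fun 𝒟 h𝒟 ↦ ?_⟩
    obtain ⟨k, hk⟩ := hf ⟨_, mem_image_of_mem _ h𝒟⟩
    exact DataEmbedding.EmbedsInto.trans hk
      (CauchyDevelopment.embedsInto_chainCauchyDevelopment hc'c
        (fun k : CauchyDevelopment.SeqIndex f ↦ f k) (CauchyDevelopment.monotone_seqIndex f)
        (0 : ℕ) k)

/-- **The input `hchain` of the Zorn frame, from the existence of one development**: if `D` has a
vacuum Cauchy development then every chain of vacuum Cauchy developments of `D` (the empty one
included) has an upper bound. [cite: ChoquetBruhatGeroch1969CMP, proof of Thm. 3 (pp. 332–333)] -/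
theorem chains_bounded_of_nonempty (h : Nonempty (VacuumCauchyDevelopment.{u} D))
    (c : Set (VacuumCauchyDevelopment.{u} D))
    (hc : IsChain (fun 𝒟₁ 𝒟₂ ↦ 𝒟₁.toCauchyDevelopment.EmbedsInto 𝒟₂.toCauchyDevelopment) c) :
    ∃ ub : VacuumCauchyDevelopment.{u} D, ∀ 𝒟 ∈ c, 𝒟.toCauchyDevelopment.EmbedsInto ub.toCauchyDevelopment := by
  rcases c.eq_empty_or_nonempty with rfl | hne
  · exact ⟨h.some, fun 𝒟 h𝒟 ↦ (notMem_empty 𝒟 h𝒟).elim⟩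
  · exact exists_upperBound_of_isChain hc hne

/-- **MGHD existence from the existence of one development and common extensions** (the Zorn
frame `exists_isMaximal_of_chains_bounded_of_common_extension` with `hchain` discharged by the
union of chains): if the datum `D` has some vacuum Cauchy development, and any two vacuum Cauchy
developments of `D` embed into a common one, then `D` has a maximal vacuum Cauchy development.
[cite: ChoquetBruhatGeroch1969CMP, Thm. 3 and its proof (pp. 332–334)] -/
theorem exists_isMaximal_of_nonempty_of_common_extension
    (hex : Nonempty (VacuumCauchyDevelopment.{u} D))
    (hce : ∀ 𝒟₁ 𝒟₂ : VacuumCauchyDevelopment.{u} D, ∃ 𝒟₃ : VacuumCauchyDevelopment.{u} D,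
      𝒟₁.toCauchyDevelopment.EmbedsInto 𝒟₃.toCauchyDevelopment ∧
        𝒟₂.toCauchyDevelopment.EmbedsInto 𝒟₃.toCauchyDevelopment) :
    ∃ 𝒟 : VacuumCauchyDevelopment.{u} D, 𝒟.IsMaximal :=
  exists_isMaximal_of_chains_bounded_of_common_extension (chains_bounded_of_nonempty hex) hce

end VacuumCauchyDevelopment

/-- **Choquet-Bruhat–Geroch 1969, Theorem 3, from local existence and common extensions.** The
named fact `choquetBruhat_geroch_exists_mghd_cauchy` (existence of the maximal globally
hyperbolic vacuum development of every smooth solution of the vacuum constraints on a connected,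
Hausdorff, second countable `3`-manifold) follows from (i) **local existence** — every such datum
has at least one vacuum Cauchy development (Choquet-Bruhat 1952; Choquet-Bruhat–Geroch, Thm. 1)
— and (ii) **common extensions** — any two vacuum Cauchy developments of such a datum embed into
a common one (Sbierski 2016, Thm. 5; see `DevelopmentGluing` for its reduction to the local
theory and Thm. 17). The order-theoretic frame is `CauchyProblemMGHDExistenceProofs`; the union of
chains (`ChainUnionDevelopment`) discharges its remaining hypothesis.
[cite: ChoquetBruhatGeroch1969CMP, Thm. 3 and its proof (pp. 332–334)] -/
theorem choquetBruhat_geroch_exists_mghd_cauchy_of_localExistence_of_common_extension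
    (hloc : ∀ (X : Type) [TopologicalSpace X] [ChartedSpace (EuclideanSpace ℝ (Fin 3)) X]
      [IsManifold (𝓡 3) ∞ X] [T2Space X] [SecondCountableTopology X] [ConnectedSpace X]
      (D : InitialDataSet (𝓡 3) X) [D.metric.HasLeviCivita], D.IsVacuumConstraintSolution →
      Nonempty (VacuumCauchyDevelopment D))
    (hce : ∀ (X : Type) [TopologicalSpace X] [ChartedSpace (EuclideanSpace ℝ (Fin 3)) X]
      [IsManifold (𝓡 3) ∞ X] [T2Space X] [SecondCountableTopology X] [ConnectedSpace X]
      (D : InitialDataSet (𝓡 3) X) [D.metric.HasLeviCivita], D.IsVacuumConstraintSolution →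
      ∀ 𝒟₁ 𝒟₂ : VacuumCauchyDevelopment D, ∃ 𝒟₃ : VacuumCauchyDevelopment D,
        𝒟₁.toCauchyDevelopment.EmbedsInto 𝒟₃.toCauchyDevelopment ∧
          𝒟₂.toCauchyDevelopment.EmbedsInto 𝒟₃.toCauchyDevelopment) :
    choquetBruhat_geroch_exists_mghd_cauchy :=
  choquetBruhat_geroch_exists_mghd_cauchy_of_chains_bounded_of_common_extension
    (fun X _ _ _ _ _ _ D _ hD ↦ VacuumCauchyDevelopment.chains_bounded_of_nonempty (hloc X D hD)) hce

end Literature.Geometry.Lorentzian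

end
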